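import Mathlib
import Summits.Ventures.PercRepro2.PMK5KernelY
import Summits.Ventures.PercRepro2.PMK5LocusFace
import Summits.Ventures.PercRepro2.PMK5LocusZero
import Summits.Ventures.PercRepro2.PMK5LocusY

/-!
# THE EQUALITY LOCUS OF THE `Y`-SLACKS ON FIVE-VERTEX BASES — THE ZERO SIDE AND THE TWO «IFF»s
(blind cell PercRepro2, mine-2 g24; on `PMK5LocusY.lean` (the positive side, `RuleY`), `PMK5KernelY.lean` and
the restricted-table machinery of `PMK5LocusFace.lean`)

The `Y`-degenerate edge sets form a down-set with SIX maximal elements `MxY = {503, 893, 990, 1011, 1017, 1018}`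
(`K₅ − {ob, ub}`, `K₅ − {oa₂, a₂u}`, `K₅ − {oa₁, a₁u}`, `K₅ − {ou, ob}`, `K₅ − {oa₂, ou}`, `K₅ − {oa₁, ou}`;
`coverZY`, one `decide +kernel`); the Kronecker numbers of the eight products RESTRICTED to a face (`kPosYm`,
`kNegYm`) carry the class sums supported inside it digitwise (`cnt3_restr_eq`, `eq_of_kron_eq`), and on each of the
six maximal faces they are EQUAL (`faceY_*`, six `decide +kernel`): every coefficient supported inside a degenerate
face vanishes (`coefY_eq_of_face`), whence **`y_K5_zero_of_face`** and the two «iff»s **`y_K5_pos_iff`** /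
**`y_K5_zero_iff`** (the `Y`-slacks vanish identically on the face of `S` ⟺ `o` is cut off from one of `a₁, a₂, b`
by the other two).  Standard axioms.
-/

namespace Summit.Ventures.PercRepro2

open Hub CovForm

namespace K5

namespace PM

/-! ## The restricted numbers and counts of `Y` -/

/-- The positive part of `Y` on the face `m` (`kPosY` with restricted tables). -/
def kPosYm (m : ℕ) : ℕ :=
  kp (restr m tQB) (restr m tQLo) (restr m tOne) + kp (restr m tQBL) (restr m tQBLo) (restr m tOne) +
  kp (restr m tQBL) (restr m tQHo) (restr m tOne) + kp (restr m tQB) (restr m tQBLHo) (restr m tOne)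
/-- The negative part of `Y` on the face `m` (`kNegY` with restricted tables). -/
def kNegYm (m : ℕ) : ℕ :=
  kp (restr m tQB) (restr m tQLoBL) (restr m tOne) + kp (restr m tQ) (restr m tQBLo) (restr m tOne) +
  kp (restr m tQBL) (restr m tQHoBH) (restr m tOne) + kp (restr m tQ) (restr m tQBLHo) (restr m tOne)
/-- The positive triple counts of `Y` on the face `m`. -/
def cntPosYm (m : ℕ) (k : Fin 10 → Fin 4) : ℕ :=
  cnt3 (restr m tQB) (restr m tQLo) (restr m tOne) k + cnt3 (restr m tQBL) (restr m tQBLo) (restr m tOne) k +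
  cnt3 (restr m tQBL) (restr m tQHo) (restr m tOne) k + cnt3 (restr m tQB) (restr m tQBLHo) (restr m tOne) k
/-- The negative triple counts of `Y` on the face `m`. -/
def cntNegYm (m : ℕ) (k : Fin 10 → Fin 4) : ℕ :=
  cnt3 (restr m tQB) (restr m tQLoBL) (restr m tOne) k + cnt3 (restr m tQ) (restr m tQBLo) (restr m tOne) k +
  cnt3 (restr m tQBL) (restr m tQHoBH) (restr m tOne) k + cnt3 (restr m tQ) (restr m tQBLHo) (restr m tOne) k

/-- `kPosYm` carries the restricted positive counts. -/
lemma kPosYm_eq (m : ℕ) : kPosYm m = ∑ k, cntPosYm m k * KB ^ idx4 k := by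
  unfold kPosYm cntPosYm
  simp only [kp_eq]
  rw [sum_add4_mul5]
/-- `kNegYm` carries the restricted negative counts. -/
lemma kNegYm_eq (m : ℕ) : kNegYm m = ∑ k, cntNegYm m k * KB ^ idx4 k := by
  unfold kNegYm cntNegYm
  simp only [kp_eq]
  rw [sum_add4_mul5]
/-- The restricted positive counts are below `2^19` (four counts `≤ 3^10`). -/
lemma cntPosYm_lt (m : ℕ) (k : Fin 10 → Fin 4) : cntPosYm m k < 2 ^ 19 := by
  unfold cntPosYm
  have := cnt3_le (restr m tQB) (restr m tQLo) (restr m tOne) k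
  have := cnt3_le (restr m tQBL) (restr m tQBLo) (restr m tOne) k
  have := cnt3_le (restr m tQBL) (restr m tQHo) (restr m tOne) k
  have := cnt3_le (restr m tQB) (restr m tQBLHo) (restr m tOne) k
  omega
/-- The restricted negative counts are below `2^19`. -/
lemma cntNegYm_lt (m : ℕ) (k : Fin 10 → Fin 4) : cntNegYm m k < 2 ^ 19 := by
  unfold cntNegYm
  have := cnt3_le (restr m tQB) (restr m tQLoBL) (restr m tOne) k
  have := cnt3_le (restr m tQ) (restr m tQBLo) (restr m tOne) k
  have := cnt3_le (restr m tQBL) (restr m tQHoBH) (restr m tOne) k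
  have := cnt3_le (restr m tQ) (restr m tQBLHo) (restr m tOne) k
  omega

/-! ## The six maximal `Y`-degenerate faces (kernel) -/

set_option maxRecDepth 100000 in
/-- The restricted numbers of `Y` agree on the face `503` = {oa1 oa2 ou a1a2 a1u a1b a2u a2b}. -/
theorem faceY_503 : kPosYm 503 = kNegYm 503 := by
  decide +kernel

set_option maxRecDepth 100000 in
/-- The restricted numbers of `Y` agree on the face `893` = {oa1 ou ob a1a2 a1u a1b a2b ub}. -/
theorem faceY_893 : kPosYm 893 = kNegYm 893 := by
  decide +kernel

set_option maxRecDepth 100000 in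
/-- The restricted numbers of `Y` agree on the face `990` = {oa2 ou ob a1a2 a1b a2u a2b ub}. -/
theorem faceY_990 : kPosYm 990 = kNegYm 990 := by
  decide +kernel

set_option maxRecDepth 100000 in
/-- The restricted numbers of `Y` agree on the face `1011` = {oa1 oa2 a1a2 a1u a1b a2u a2b ub}. -/
theorem faceY_1011 : kPosYm 1011 = kNegYm 1011 := by
  decide +kernel

set_option maxRecDepth 100000 in
/-- The restricted numbers of `Y` agree on the face `1017` = {oa1 ob a1a2 a1u a1b a2u a2b ub}. -/
theorem faceY_1017 : kPosYm 1017 = kNegYm 1017 := by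
  decide +kernel

set_option maxRecDepth 100000 in
/-- The restricted numbers of `Y` agree on the face `1018` = {oa2 ob a1a2 a1u a1b a2u a2b ub}. -/
theorem faceY_1018 : kPosYm 1018 = kNegYm 1018 := by
  decide +kernel

/-- **Every coefficient of `Y` supported inside a face with equal restricted numbers vanishes.** -/
theorem coefY_eq_of_face (m : ℕ) (hz : kPosYm m = kNegYm m) (k : Fin 10 → Fin 4)
    (hk : ∀ e : Fin 10, k e ≠ 0 → m.testBit e = true) : cntPosY k = cntNegY k := by
  have h := eq_of_kron_eq _ _ (cntPosYm_lt m) (cntNegYm_lt m) (kPosYm_eq m) (kNegYm_eq m) hz k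
  unfold cntPosYm cntNegYm at h
  simp only [cnt3_restr_eq hk] at h
  unfold cntPosY cntNegY
  omega

/-- The six maximal `Y`-degenerate edge sets. -/
def MxY : Fin 6 → ℕ := ![503, 893, 990, 1011, 1017, 1018]

set_option maxRecDepth 100000 in
/-- **Every `Y`-degenerate edge set lies inside one of the six maximal ones.** -/
theorem coverZY : ∀ m : Fin 1024, RuleY m = true →
    ∃ i : Fin 6, ∀ e : Fin 10, (m : ℕ).testBit e = true → (MxY i).testBit e = true := by
  decide +kernel

/-- The restricted numbers agree on each maximal `Y`-degenerate face. -/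
theorem faceY_all : ∀ i : Fin 6, kPosYm (MxY i) = kNegYm (MxY i) := by
  intro i
  fin_cases i
  exacts [faceY_503, faceY_893, faceY_990, faceY_1011, faceY_1017, faceY_1018]

section Face

variable {R : Type*} [Field R] [LinearOrder R] [IsStrictOrderedRing R]

omit [LinearOrder R] [IsStrictOrderedRing R] in
/-- **THE EQUALITY LOCUS OF THE `Y`-SLACKS — THE ZERO SIDE (Bernstein form)**: on every `Y`-degenerate edge set
`m`, `Σ_k bern q k · (cntPosY k − cntNegY k) = 0` at every weight vector `q` supported on `m`. -/
theorem y_K5_zero_of_face (m : ℕ) (hm : m < 1024) (hr : RuleY m = true) (q : Fin 10 → R)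
    (hq₀ : ∀ e : Fin 10, m.testBit e = false → q e = 0) :
    ∑ k, bern q k * ((cntPosY k : ℕ) - (cntNegY k : ℕ) : R) = 0 := by
  refine Finset.sum_eq_zero fun k _ => ?_
  by_cases hk : ∀ e : Fin 10, k e ≠ 0 → m.testBit e = true
  · obtain ⟨i, hi⟩ := coverZY ⟨m, hm⟩ hr
    have hc := coefY_eq_of_face (MxY i) (faceY_all i) k fun e he => hi e (hk e he)
    rw [hc, sub_self, mul_zero]
  · obtain ⟨e, he⟩ := not_forall.1 hk
    obtain ⟨hke, hme⟩ := Classical.not_imp.1 he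
    have hqe : q e = 0 := hq₀ e (by simpa using hme)
    have hb : bern q k = 0 := by
      unfold bern
      apply Finset.prod_eq_zero (Finset.mem_univ e)
      rw [hqe, zero_pow (fun h => hke (Fin.ext (by simpa using h)))]
      simp
    rw [hb, zero_mul]

/-- **THE EQUALITY LOCUS OF THE `Y`-SLACKS, FIRST «IFF»**: `Y > 0` at every weight vector interior on `m` ⟺ `m` is
not `Y`-degenerate. -/
theorem y_K5_pos_iff (m : ℕ) (hm : m < 1024) :
    (∀ q : Fin 10 → R, (∀ e : Fin 10, m.testBit e = true → 0 < q e ∧ q e < 1) →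
      (∀ e : Fin 10, m.testBit e = false → q e = 0) →
      0 < ∑ k, bern q k * ((cntPosY k : ℕ) - (cntNegY k : ℕ) : R)) ↔ RuleY m = false := by
  constructor
  · intro h
    rcases Bool.eq_false_or_eq_true (RuleY m) with hr | hr
    · exfalso
      have hpos := h (centre (R := R) m) (fun e he => centre_on_pos he) (fun e he => centre_off he)
      have hzero := y_K5_zero_of_face m hm hr (centre (R := R) m) (fun e he => centre_off he)
      rw [hzero] at hpos
      exact lt_irrefl _ hpos
    · exact hr
  · intro hr q hq₁ hq₀
    exact y_K5_pos_of_face m hm hr q hq₁ hq₀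

/-- **THE EQUALITY LOCUS OF THE `Y`-SLACKS, SECOND «IFF»**: `Y = 0` at every admissible weight vector supported on
`m` ⟺ `m` is `Y`-degenerate. -/
theorem y_K5_zero_iff (m : ℕ) (hm : m < 1024) :
    (∀ q : Fin 10 → R, (∀ e : Fin 10, 0 ≤ q e ∧ q e ≤ 1) →
      (∀ e : Fin 10, m.testBit e = false → q e = 0) →
      ∑ k, bern q k * ((cntPosY k : ℕ) - (cntNegY k : ℕ) : R) = 0) ↔ RuleY m = true := by
  constructor
  · intro h
    rcases Bool.eq_false_or_eq_true (RuleY m) with hr | hr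
    · exact hr
    · exfalso
      have hpos := y_K5_pos_of_face m hm hr (centre (R := R) m)
        (fun e he => centre_on_pos he) (fun e he => centre_off he)
      have hzero := h (centre (R := R) m) (centre_01 m) (fun e he => centre_off he)
      rw [hzero] at hpos
      exact lt_irrefl _ hpos
  · intro hr q _ hq₀
    exact y_K5_zero_of_face m hm hr q hq₀

end Face

end PM

end K5

end Summit.Ventures.PercRepro2
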